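import Summits.CriticalPhenomena.PercolationContinuityZ3.Theorems.PercNearOneGluingNoHeavyLowerTailKNConj1Holds
import HarnessLib

/-!
# Audit of p205010 — the FINITE-GRAPH theorems of the chain, restated with every project definition unfolded

Adversarial audit `run/shared/lean/prim/audit-p205010/README.md`, checklist (d)/(e) read at the level that
matters for meaning: the three finite-graph statements the chain proves unconditionally —

* Kozma–Nitzan **Conjecture 1** (`kozmaNitzan2024_conjecture1_holds`, prim-ineq-gen-6, on top of p205010),
* the crux **`AdditiveGluing`** (stmt-CriticalPhenomena-4576, `CSH.additiveGluing_holds`, p205010),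
* Kozma–Nitzan **Conjecture 3** (`CSH.kozmaNitzan_conjecture3_holds`, p205010) —

are re-stated below with the two project definitions they mention, `prodBernoulli` and `openConn`
(through `openGraph`), replaced by their bodies, so that only Mathlib notions remain
(`MeasureTheory.Measure.comap`, `Measure.infinitePi`, `Measure.dirac`, `unitInterval.toNNReal`,
`unitInterval.symm`, `SimpleGraph.fromEdgeSet`, `SimpleGraph.Reachable`, `Measure.real`, `Finset`, `Sym2`),
and each is proved by handing the tree theorem to `exact`: the kernel confirms that the tree theorems ARE
the statements "on every finite graph `Fin n` with independent edges `e` open with probability `w e`, …"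
in Mathlib's own words.  The unfolding lemmas `prodBernoulli_unfold`, `openConn_unfold` are `rfl`, and
`isProbabilityMeasure_prodBernoulli_unfolded` records that the unfolded `Measure.comap … (infinitePi …)` has
total mass `1` (it is not the zero-measure fallback of `Measure.comap`).  Companion files: the summit
statement `θ_{ℤ^d}(p_c) = 0` unfolded — `…Theorems/PercNearOneGluingNoHeavyLowerTailClosureAudit.lean`
(prim-ineq-prove-1) and `…Theorems/Audit/ThetaAtOne.lean` (prim-hp-7, `θ(1) = 1`).  Nothing here is used by
the chain under audit; no new definitions.  (prim-gen-induct gen 11, 2026-08-20.)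
-/

noncomputable section

namespace Summit.CriticalPhenomena.PercolationContinuityZ3.Theorems.Audit

open MeasureTheory Literature.Probability.Percolation Literature.Probability.LatticeModels
open Summit.CriticalPhenomena.PercolationContinuityZ3.Theses

/-- The inhomogeneous product Bernoulli measure of the finite-graph statements, unfolded to Mathlib: the
pull-back along `s ↦ (i ↦ i ∈ s)` of the `infinitePi` product of the two-point laws
`w i • δ_True + (1 - w i) • δ_False` (exactly Mathlib's `ProbabilityTheory.setBernoulli` with an
`i`-dependent parameter). `rfl`. [folklore] -/
theorem prodBernoulli_unfold {ι : Type*} (w : ι → unitInterval) :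
    prodBernoulli w =
      Measure.comap (fun (s : Set ι) (i : ι) => i ∈ s)
        (Measure.infinitePi fun i : ι =>
          unitInterval.toNNReal (w i) • Measure.dirac True +
            unitInterval.toNNReal (unitInterval.symm (w i)) • Measure.dirac False) :=
  rfl

/-- The unfolded measure is a probability measure (total mass `1`): `Measure.comap` is taken along the
measurable equivalence `Set ι ≃ (ι → Prop)`, so it is not in its zero-measure fallback (the tree instance
`instIsProbabilityMeasureProdBernoulli`, same term as Mathlib's instance for `setBernoulli`). [folklore] -/
theorem isProbabilityMeasure_prodBernoulli_unfolded {ι : Type*} (w : ι → unitInterval) :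
    IsProbabilityMeasure
      (Measure.comap (fun (s : Set ι) (i : ι) => i ∈ s)
        (Measure.infinitePi fun i : ι =>
          unitInterval.toNNReal (w i) • Measure.dirac True +
            unitInterval.toNNReal (unitInterval.symm (w i)) • Measure.dirac False)) :=
  instIsProbabilityMeasureProdBernoulli w

/-- The connection event of the finite-graph statements, unfolded to Mathlib: `x ↔ y` in the configuration
`ω ⊆ Sym2 V` iff `y` is reachable from `x` in `SimpleGraph.fromEdgeSet ω` (the graph whose edges are the
non-diagonal pairs in `ω`). `rfl`. [folklore] -/
theorem openConn_unfold {V : Type*} (x y : V) :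
    (openConn x y : Set (BondConfig V)) = {ω : Set (Sym2 V) | (SimpleGraph.fromEdgeSet ω).Reachable x y} :=
  rfl

/-- **Kozma–Nitzan's Conjecture 1 (arXiv:2401.12397, p. 3) as proved in the tree, in Mathlib vocabulary.**
For every `n`, every weight `w : Sym2 (Fin n) → [0,1]`, every `A ⊆ Fin n`, all `o b : Fin n` and every real
`t`: writing `μ_w` for the unfolded product measure and `x ↔ y` for `(fromEdgeSet ω).Reachable x y`, if
`t ≤ μ_w(a ↔ b)` for all `a ∈ A` then `μ_w(o ↔ A) · t ≤ μ_w(o ↔ b)` — i.e.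
`P(o ↔ b) ≥ P(o ↔ A) · min_{a ∈ A} P(a ↔ b)`. Proof: `exact kozmaNitzan2024_conjecture1_holds`.
[cite: KozmaNitzan2024, Conjecture 1 (p. 3)] -/
theorem kozmaNitzan_conjecture1_unfolded :
    ∀ (n : ℕ) (w : Sym2 (Fin n) → unitInterval) (A : Finset (Fin n)) (o b : Fin n) (t : ℝ),
      (∀ a ∈ A, t ≤
        (Measure.comap (fun (s : Set (Sym2 (Fin n))) (i : Sym2 (Fin n)) => i ∈ s)
          (Measure.infinitePi fun i : Sym2 (Fin n) =>
            unitInterval.toNNReal (w i) • Measure.dirac True +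
              unitInterval.toNNReal (unitInterval.symm (w i)) • Measure.dirac False)).real
          {ω : Set (Sym2 (Fin n)) | (SimpleGraph.fromEdgeSet ω).Reachable a b}) →
      (Measure.comap (fun (s : Set (Sym2 (Fin n))) (i : Sym2 (Fin n)) => i ∈ s)
          (Measure.infinitePi fun i : Sym2 (Fin n) =>
            unitInterval.toNNReal (w i) • Measure.dirac True +
              unitInterval.toNNReal (unitInterval.symm (w i)) • Measure.dirac False)).real
          (⋃ a ∈ A, {ω : Set (Sym2 (Fin n)) | (SimpleGraph.fromEdgeSet ω).Reachable o a}) * t ≤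
        (Measure.comap (fun (s : Set (Sym2 (Fin n))) (i : Sym2 (Fin n)) => i ∈ s)
          (Measure.infinitePi fun i : Sym2 (Fin n) =>
            unitInterval.toNNReal (w i) • Measure.dirac True +
              unitInterval.toNNReal (unitInterval.symm (w i)) • Measure.dirac False)).real
          {ω : Set (Sym2 (Fin n)) | (SimpleGraph.fromEdgeSet ω).Reachable o b} :=
  kozmaNitzan2024_conjecture1_holds

/-- **The crux `AdditiveGluing` (stmt-CriticalPhenomena-4576) as proved by p205010, in Mathlib
vocabulary**: on every finite weighted graph, for every slack `t ≥ 0` with `μ_w(a ↔ b) ≥ 1 - t` for all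
`a ∈ A`, `μ_w(o ↔ A) - t ≤ μ_w(o ↔ b)` — i.e. `P(o ↔ b) ≥ P(o ↔ A) - max_{a ∈ A} P(a ↮ b)`.
Proof: `exact CSH.additiveGluing_holds`. [cite: KozmaNitzan2024, Conj. 1 (p. 3)] -/
theorem additiveGluing_unfolded :
    ∀ (n : ℕ) (w : Sym2 (Fin n) → unitInterval) (A : Finset (Fin n)) (o b : Fin n) (t : ℝ), 0 ≤ t →
      (∀ a ∈ A, 1 - t ≤
        (Measure.comap (fun (s : Set (Sym2 (Fin n))) (i : Sym2 (Fin n)) => i ∈ s)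
          (Measure.infinitePi fun i : Sym2 (Fin n) =>
            unitInterval.toNNReal (w i) • Measure.dirac True +
              unitInterval.toNNReal (unitInterval.symm (w i)) • Measure.dirac False)).real
          {ω : Set (Sym2 (Fin n)) | (SimpleGraph.fromEdgeSet ω).Reachable a b}) →
      (Measure.comap (fun (s : Set (Sym2 (Fin n))) (i : Sym2 (Fin n)) => i ∈ s)
          (Measure.infinitePi fun i : Sym2 (Fin n) =>
            unitInterval.toNNReal (w i) • Measure.dirac True +
              unitInterval.toNNReal (unitInterval.symm (w i)) • Measure.dirac False)).real
          (⋃ a ∈ A, {ω : Set (Sym2 (Fin n)) | (SimpleGraph.fromEdgeSet ω).Reachable o a}) - t ≤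
        (Measure.comap (fun (s : Set (Sym2 (Fin n))) (i : Sym2 (Fin n)) => i ∈ s)
          (Measure.infinitePi fun i : Sym2 (Fin n) =>
            unitInterval.toNNReal (w i) • Measure.dirac True +
              unitInterval.toNNReal (unitInterval.symm (w i)) • Measure.dirac False)).real
          {ω : Set (Sym2 (Fin n)) | (SimpleGraph.fromEdgeSet ω).Reachable o b} :=
  CSH.additiveGluing_holds

/-- **Kozma–Nitzan's Conjecture 3 (arXiv:2401.12397, p. 15) as proved by p205010, in Mathlib
vocabulary.** For every `ε > 0` there is `δ > 0` such that for every `n`, every weight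
`w : Sym2 (Fin n) → [0,1]`, every `A ⊆ Fin n` and all `o b : Fin n`: if `μ_w(o ↔ A) > 1 - δ` and
`μ_w(a ↔ b) > 1 - δ` for all `a ∈ A` then `μ_w(o ↔ b) > 1 - ε`. Proof: `exact CSH.kozmaNitzan_conjecture3_holds`.
[cite: KozmaNitzan2024, Conjecture 3 (p. 15)] -/
theorem kozmaNitzan_conjecture3_unfolded :
    ∀ ε : ℝ, 0 < ε → ∃ δ : ℝ, 0 < δ ∧
      ∀ (n : ℕ) (w : Sym2 (Fin n) → unitInterval) (A : Finset (Fin n)) (o b : Fin n),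
        1 - δ < (Measure.comap (fun (s : Set (Sym2 (Fin n))) (i : Sym2 (Fin n)) => i ∈ s)
            (Measure.infinitePi fun i : Sym2 (Fin n) =>
              unitInterval.toNNReal (w i) • Measure.dirac True +
                unitInterval.toNNReal (unitInterval.symm (w i)) • Measure.dirac False)).real
            (⋃ a ∈ A, {ω : Set (Sym2 (Fin n)) | (SimpleGraph.fromEdgeSet ω).Reachable o a}) →
        (∀ a ∈ A, 1 - δ <
          (Measure.comap (fun (s : Set (Sym2 (Fin n))) (i : Sym2 (Fin n)) => i ∈ s)
            (Measure.infinitePi fun i : Sym2 (Fin n) =>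
              unitInterval.toNNReal (w i) • Measure.dirac True +
                unitInterval.toNNReal (unitInterval.symm (w i)) • Measure.dirac False)).real
            {ω : Set (Sym2 (Fin n)) | (SimpleGraph.fromEdgeSet ω).Reachable a b}) →
        1 - ε <
          (Measure.comap (fun (s : Set (Sym2 (Fin n))) (i : Sym2 (Fin n)) => i ∈ s)
            (Measure.infinitePi fun i : Sym2 (Fin n) =>
              unitInterval.toNNReal (w i) • Measure.dirac True +
                unitInterval.toNNReal (unitInterval.symm (w i)) • Measure.dirac False)).real
            {ω : Set (Sym2 (Fin n)) | (SimpleGraph.fromEdgeSet ω).Reachable o b} :=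
  CSH.kozmaNitzan_conjecture3_holds

/-- The crux decl closed by p205010 (`PercNearOneGluingNoHeavy.NoHeavyLowerTail`, the serving route of
stmt-CriticalPhenomena-4575) and the decl the item was filed under (`PercNearOneGluing.NoHeavyLowerTail`)
are the same term. [folklore] -/
theorem noHeavyLowerTail_routes_agree :
    PercNearOneGluingNoHeavy.NoHeavyLowerTail = PercNearOneGluing.NoHeavyLowerTail :=
  rfl

/-- Hence the decl of stmt-CriticalPhenomena-4575 as filed (route `PercNearOneGluing`) is a theorem.
[folklore] -/
theorem noHeavyLowerTail_asFiled : PercNearOneGluing.NoHeavyLowerTail :=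
  noHeavyLowerTail_routes_agree ▸ CSH.noHeavyLowerTail_holds

end Summit.CriticalPhenomena.PercolationContinuityZ3.Theorems.Audit

end
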